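import Literature.MathematicalPhysics.KineticTheory.SiteChainResponseBackwardLimit
import HarnessLib

/-!
# The backward identity and the finite-time response identity of site-inhomogeneous chains

Topic `Literature/MathematicalPhysics/KineticTheory`, grouping namespace `…KineticTheory.HeatConduction`.
For the Langevin kernels `P_t` of a uniformly confining site-dependent chain (`N ≥ 1`, `T_L, T_R ≥ 0`)
under the exponential moment bound (EM) of `SiteChainResponsePairing.lean`, an exponent `θ` with
`e^{(θ+ϑ)H}`, `(1 + p_0² + p_{N-1}²) e^{(θ+ϑ)H}` Lebesgue integrable, and `φ ∈ C²`, `|φ| ≤ C e^{ϑH}`: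

* `SiteChain.UniformlyConfining.backward_identity_integral` — **the weak backward Kolmogorov equation
  tested against `e^{θH}`**: for every `t ≥ 0`,
  `∫ e^{θH} P_t φ dx - ∫ e^{θH} φ dx = ∫₀ᵗ ( 2γ ∫ e^{θH} P_s φ dx + ∫ P_s φ · L̂(e^{θH}) dx ) ds`,
  `L̂(e^{θH}) = γ e^{θH} (T_L(θ²p_0² + θ) + θp_0² + T_R(θ²p_{N-1}² + θ) + θp_{N-1}²)` (`Lᵀ = L̂ + 2γ`),
  obtained from the truncated identity (`SiteChainResponseBackward.lean`) by `R → ∞`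
  (`SiteChainResponseBackwardLimit.lean`);
* `SiteChain.UniformlyConfining.finite_time_response_identity` — with baths at `T ± δ/2` and the
  weight at the MEAN temperature, `Lᵀ e^{-H/T} = δ (γ/2T²)(p_0² - p_{N-1}²) e^{-H/T}`, whence
  `∫ e^{-H/T} P_t φ dx - ∫ e^{-H/T} φ dx = δ (γ/2T²) ∫₀ᵗ ∫ P_s φ · e^{-H/T}(p_0² - p_{N-1}²) dx ds`
  (Duhamel at the level of the Gibbs weight; Kundu–Dhar–Narayan's open-chain response formula
  before `t → ∞`);
* `measurable_oddMoment_pairing`, `integral_expWeight_oddMoment_eq_zero` (`∫ e^{-H/T}(p_0² - p_{N-1}²) dx = 0`,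
  from the identity with `φ ≡ 1`).

## References

* A. Kundu, A. Dhar, O. Narayan, J. Stat. Mech. (2009) L03001, p. 3 (open-chain response formula).
* N. Cuneo, J.-P. Eckmann, M. Hairer, L. Rey-Bellet, Electron. J. Probab. **23** (2018) no. 55, §3.1.
* M. Hairer, A. J. Majda, *A simple framework to justify linear response theory*, Nonlinearity **23**
  (2010) 909–922, Thm 2.3.
-/

noncomputable section

open MeasureTheory ProbabilityTheory Filter Topology Set
open scoped NNReal ENNReal ContDiff

namespace Literature.MathematicalPhysics.KineticTheory.HeatConduction

open Literature.Probability.Process Literature.MathematicalPhysics.KineticTheory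

variable {N : ℕ}

namespace SiteChain.UniformlyConfining

variable {P : SiteChain} (hP : P.UniformlyConfining)
include hP

section Main

variable {T_L T_R : ℝ} {ϑ K r : ℝ}
  (hK : ∀ (t : ℝ≥0) (x : PhaseSpace N),
    ∫⁻ y, ENNReal.ofReal (Real.exp (ϑ * P.hamiltonian N y)) ∂(P.langevinKernel N T_L T_R t x) ≤
      ENNReal.ofReal (K * Real.exp (r * t) * Real.exp (ϑ * P.hamiltonian N x)))
  (hK0 : 0 ≤ K) (hr : 0 ≤ r) (hN : 0 < N) (hTL : 0 ≤ T_L) (hTR : 0 ≤ T_R) {θ : ℝ}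
  (hθ0 : Integrable fun x : PhaseSpace N => Real.exp ((θ + ϑ) * P.hamiltonian N x))
  (hθ1 : Integrable fun x : PhaseSpace N =>
    (1 + x.2 ⟨0, hN⟩ ^ 2 + x.2 ⟨N - 1, by omega⟩ ^ 2) * Real.exp ((θ + ϑ) * P.hamiltonian N x))
  {φ : PhaseSpace N → ℝ} (hφ2 : ContDiff ℝ 2 φ) {C : ℝ}
  (hφ : ∀ y, |φ y| ≤ C * Real.exp (ϑ * P.hamiltonian N y))
include hK hK0 hr hTL hTR hθ0 hθ1 hφ2 hφ

/-- **The backward identity for the energy-weighted pairing, integrated form.** For every `t ≥ 0`: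
`∫ e^{θH} P_t φ dx - ∫ e^{θH} φ dx = ∫₀ᵗ ( 2γ ∫ e^{θH} P_s φ dx + ∫ P_s φ · L̂(e^{θH}) dx ) ds`,
i.e. `= ∫₀ᵗ ∫ P_s φ · Lᵀ(e^{θH}) dx ds` with `Lᵀ = L̂ + 2γ` the Lebesgue transpose of the
generator. [cite: CuneoEckmannHairerReyBellet2018, §3.1] -/
theorem backward_identity_integral (t : ℝ≥0) :
    (∫ x, Real.exp (θ * P.hamiltonian N x) * ∫ y, φ y ∂(P.langevinKernel N T_L T_R t x)) -
      ∫ x, Real.exp (θ * P.hamiltonian N x) * φ x =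
      ∫ s in (0 : ℝ)..t,
        (2 * P.γ * (∫ x, Real.exp (θ * P.hamiltonian N x) * ∫ y, φ y ∂(P.langevinKernel N T_L T_R s.toNNReal x)) +
          ∫ x, (∫ y, φ y ∂(P.langevinKernel N T_L T_R s.toNNReal x)) *
            (Real.exp (θ * P.hamiltonian N x) *
              (P.γ * (T_L * (θ ^ 2 * x.2 ⟨0, hN⟩ ^ 2 + θ) + θ * x.2 ⟨0, hN⟩ ^ 2 +
                (T_R * (θ ^ 2 * x.2 ⟨N - 1, by omega⟩ ^ 2 + θ) + θ * x.2 ⟨N - 1, by omega⟩ ^ 2))))) := by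
  have hφc : Continuous φ := hφ2.continuous
  have hγ := hP.γ_nonneg
  have hid := fun n : ℕ => hP.truncated_integrated_identity N T_L T_R θ hφ2 hN n t
  have ha := hP.tendsto_integral_cutoff_lhs hK hK0 hθ0 hφc hφ t
  have hb := hP.tendsto_integral_cutoff_diag hθ0 hφc hφ (θ := θ)
  -- the time integral: dominated convergence with a constant majorant on `(0, t]`
  have hC : 0 ≤ C := by
    have := (abs_nonneg _).trans (hφ 0)
    exact nonneg_of_mul_nonneg_left this (Real.exp_pos _)
  obtain ⟨K', hK'0, hK'⟩ := hP.exists_bound_cutoff_gen hK hK0 hφ hN hTL hTR (θ := θ) (r := r)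
  set I₁ : ℝ := ∫ x : PhaseSpace N, Real.exp ((θ + ϑ) * P.hamiltonian N x) with hI₁_def
  set Iw : ℝ := ∫ x : PhaseSpace N, (1 + x.2 ⟨0, hN⟩ ^ 2 + x.2 ⟨N - 1, by omega⟩ ^ 2) *
    Real.exp ((θ + ϑ) * P.hamiltonian N x) with hIw_def
  have hI₁0 : 0 ≤ I₁ := integral_nonneg fun x => (Real.exp_pos _).le
  have hIw0 : 0 ≤ Iw := integral_nonneg fun x => by positivity
  set M0 : ℝ := Real.exp (r * t) * (2 * P.γ * (C * K * I₁) + K' * Iw) with hM0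
  have hc : Tendsto (fun n : ℕ => ∫ s in (0 : ℝ)..t,
      (2 * P.γ * (∫ x, (smoothCutoff (P.hamiltonian N x / (n + 1)) * Real.exp (θ * P.hamiltonian N x)) *
          ∫ y, smoothCutoff (P.hamiltonian N y / (n + 1)) * φ y ∂(P.langevinKernel N T_L T_R s.toNNReal x)) +
        ∫ x, (∫ y, smoothCutoff (P.hamiltonian N y / (n + 1)) * φ y ∂(P.langevinKernel N T_L T_R s.toNNReal x)) *
          sdeGenerator (fun y => -P.langevinDrift N y) (P.noiseVecL N T_L) (P.noiseVecR N T_R)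
            (fun y => smoothCutoff (P.hamiltonian N y / (n + 1)) * Real.exp (θ * P.hamiltonian N y)) x)) atTop
      (𝓝 (∫ s in (0 : ℝ)..t,
        (2 * P.γ * (∫ x, Real.exp (θ * P.hamiltonian N x) * ∫ y, φ y ∂(P.langevinKernel N T_L T_R s.toNNReal x)) +
          ∫ x, (∫ y, φ y ∂(P.langevinKernel N T_L T_R s.toNNReal x)) *
            (Real.exp (θ * P.hamiltonian N x) *
              (P.γ * (T_L * (θ ^ 2 * x.2 ⟨0, hN⟩ ^ 2 + θ) + θ * x.2 ⟨0, hN⟩ ^ 2 +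
                (T_R * (θ ^ 2 * x.2 ⟨N - 1, by omega⟩ ^ 2 + θ) + θ * x.2 ⟨N - 1, by omega⟩ ^ 2))))))) := by
    refine intervalIntegral.tendsto_integral_filter_of_dominated_convergence (fun _ => M0)
      (Eventually.of_forall fun n => ?_)
      (Eventually.of_forall fun n => Eventually.of_forall fun s hs => ?_)
      intervalIntegrable_const (Eventually.of_forall fun s _ => ?_)
    · have hR : (0 : ℝ) < n + 1 := by positivity
      exact ((continuous_const.mul (hP.continuous_pairAct_truncPair N T_L T_R θ hφ2 hR)).add
        (hP.continuous_pairing_truncPair N T_L T_R θ hφ2 hR)).aestronglyMeasurable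
    · rw [uIoc_of_le t.coe_nonneg] at hs
      have hs0 : 0 ≤ s := hs.1.le
      have hexp : Real.exp (r * s) ≤ Real.exp (r * t) := Real.exp_le_exp.2 (mul_le_mul_of_nonneg_left hs.2 hr)
      have h1 : ‖∫ x, (smoothCutoff (P.hamiltonian N x / (n + 1)) * Real.exp (θ * P.hamiltonian N x)) *
            ∫ y, smoothCutoff (P.hamiltonian N y / (n + 1)) * φ y ∂(P.langevinKernel N T_L T_R s.toNNReal x)‖ ≤
          C * K * Real.exp (r * s) * I₁ := by
        rw [hI₁_def, ← integral_const_mul]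
        refine norm_integral_le_of_norm_le (hθ0.const_mul _) (Eventually.of_forall fun x => ?_)
        rw [Real.norm_eq_abs, abs_mul]
        have hin := hP.abs_integral_langevinKernel_mul_le hK hφ hK0 s.toNNReal x
          (g := fun y => smoothCutoff (P.hamiltonian N y / (n + 1))) (fun y => by
            rw [abs_of_nonneg (smoothCutoff_nonneg _)]; exact smoothCutoff_le_one _)
        rw [Real.coe_toNNReal _ hs0] at hin
        have hw := truncExpWeight_mem_Icc (θ := θ) ((n : ℝ) + 1) (P.hamiltonian N x)
        rw [show (θ + ϑ) * P.hamiltonian N x = θ * P.hamiltonian N x + ϑ * P.hamiltonian N x by ring, Real.exp_add]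
        calc _ ≤ Real.exp (θ * P.hamiltonian N x) * (C * (K * Real.exp (r * s) * Real.exp (ϑ * P.hamiltonian N x))) := by
              refine mul_le_mul ?_ hin (abs_nonneg _) (Real.exp_pos _).le
              rw [abs_of_nonneg hw.1]; exact hw.2
          _ = _ := by ring
      have h2 : ‖∫ x, (∫ y, smoothCutoff (P.hamiltonian N y / (n + 1)) * φ y ∂(P.langevinKernel N T_L T_R s.toNNReal x)) *
            sdeGenerator (fun y => -P.langevinDrift N y) (P.noiseVecL N T_L) (P.noiseVecR N T_R)
              (fun y => smoothCutoff (P.hamiltonian N y / (n + 1)) * Real.exp (θ * P.hamiltonian N y)) x‖ ≤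
          K' * Real.exp (r * s) * Iw := by
        rw [hIw_def, ← integral_const_mul]
        refine norm_integral_le_of_norm_le (hθ1.const_mul _) (Eventually.of_forall fun x => ?_)
        rw [Real.norm_eq_abs]
        have h := hK' n s.toNNReal x
        rwa [Real.coe_toNNReal _ hs0] at h
      calc _ ≤ ‖2 * P.γ * (∫ x, (smoothCutoff (P.hamiltonian N x / (n + 1)) * Real.exp (θ * P.hamiltonian N x)) *
              ∫ y, smoothCutoff (P.hamiltonian N y / (n + 1)) * φ y ∂(P.langevinKernel N T_L T_R s.toNNReal x))‖ + _ :=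
            norm_add_le _ _
        _ ≤ 2 * P.γ * (C * K * Real.exp (r * s) * I₁) + K' * Real.exp (r * s) * Iw := by
            refine add_le_add ?_ h2
            rw [norm_mul, Real.norm_eq_abs, abs_of_nonneg (by positivity : (0:ℝ) ≤ 2 * P.γ)]
            exact mul_le_mul_of_nonneg_left h1 (by positivity)
        _ ≤ M0 := by
            rw [hM0]
            have hCI : 0 ≤ C * K * I₁ := by positivity
            have hKI : 0 ≤ K' * Iw := mul_nonneg hK'0 hIw0
            nlinarith [mul_le_mul_of_nonneg_left hexp hCI, mul_le_mul_of_nonneg_left hexp hKI,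
              mul_nonneg hγ hCI, mul_nonneg (mul_nonneg hγ hCI) (Real.exp_pos (r * t)).le]
    · exact ((hP.tendsto_integral_cutoff_lhs hK hK0 hθ0 hφc hφ s.toNNReal).const_mul (2 * P.γ)).add
        (hP.tendsto_integral_cutoff_gen hK hK0 hφc hφ hN hTL hTR hθ1 s.toNNReal)
  have h2 := ha.sub hb
  simp_rw [hid] at h2
  exact tendsto_nhds_unique h2 hc

end Main

/-! ### The finite-time response identity -/

section FiniteTime

variable {T δ : ℝ} {ϑ K r : ℝ}
  (hK : ∀ (t : ℝ≥0) (x : PhaseSpace N),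
    ∫⁻ y, ENNReal.ofReal (Real.exp (ϑ * P.hamiltonian N y)) ∂(P.langevinKernel N (T + δ / 2) (T - δ / 2) t x) ≤
      ENNReal.ofReal (K * Real.exp (r * t) * Real.exp (ϑ * P.hamiltonian N x)))
  (hK0 : 0 ≤ K) (hr : 0 ≤ r) (hN : 0 < N) (hT : 0 < T) (hTL : 0 ≤ T + δ / 2) (hTR : 0 ≤ T - δ / 2)
  (hθ0 : Integrable fun x : PhaseSpace N => Real.exp ((-1 / T + ϑ) * P.hamiltonian N x))
  (hθ1 : Integrable fun x : PhaseSpace N =>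
    (1 + x.2 ⟨0, hN⟩ ^ 2 + x.2 ⟨N - 1, by omega⟩ ^ 2) * Real.exp ((-1 / T + ϑ) * P.hamiltonian N x))
  {φ : PhaseSpace N → ℝ} (hφ2 : ContDiff ℝ 2 φ) {C : ℝ}
  (hφ : ∀ y, |φ y| ≤ C * Real.exp (ϑ * P.hamiltonian N y))
include hK hK0 hr hT hTL hTR hθ0 hθ1 hφ2 hφ

/-- **The finite-time response identity of a site-dependent chain.** With baths at `T ± δ/2` and the
Gibbs weight at the mean temperature `T`, for every `t ≥ 0`:
`∫ e^{-H/T} P_t φ dx - ∫ e^{-H/T} φ dx = δ (γ/2T²) ∫₀ᵗ ∫ P_s φ · e^{-H/T} (p_0² - p_{N-1}²) dx ds`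
(the transposed generator on the mean-temperature weight is `Lᵀ e^{-H/T} = δ(γ/2T²)(p_0² - p_{N-1}²)e^{-H/T}`,
a potential-independent algebraic identity). [cite: KunduDharNarayan2009, p. 3] -/
theorem finite_time_response_identity (t : ℝ≥0) :
    (∫ x, Real.exp (-1 / T * P.hamiltonian N x) * ∫ y, φ y ∂(P.langevinKernel N (T + δ / 2) (T - δ / 2) t x)) -
      ∫ x, Real.exp (-1 / T * P.hamiltonian N x) * φ x =
      δ * (P.γ / (2 * T ^ 2)) * ∫ s in (0 : ℝ)..t,
        ∫ x, (∫ y, φ y ∂(P.langevinKernel N (T + δ / 2) (T - δ / 2) s.toNNReal x)) *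
          (Real.exp (-1 / T * P.hamiltonian N x) * (x.2 ⟨0, hN⟩ ^ 2 - x.2 ⟨N - 1, by omega⟩ ^ 2)) := by
  have hid := hP.backward_identity_integral hK hK0 hr hN hTL hTR hθ0 hθ1 hφ2 hφ t
  rw [hid, ← intervalIntegral.integral_const_mul]
  refine intervalIntegral.integral_congr fun s _ => ?_
  have hφm := hφ2.continuous.stronglyMeasurable
  have hI1 := hP.integrable_expWeight_mul_forecast hK hφ hK0 hφm hθ0 s.toNNReal
  have hI2 := hP.integrable_forecast_mul_oddMoment hK hφ hK0 hN hφm hθ1 s.toNNReal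
  -- the algebra of the transposed generator on the mean-temperature weight
  have halg : ∀ p q : ℝ, P.γ * ((T + δ / 2) * ((-1 / T) ^ 2 * p ^ 2 + -1 / T) + -1 / T * p ^ 2 +
      ((T - δ / 2) * ((-1 / T) ^ 2 * q ^ 2 + -1 / T) + -1 / T * q ^ 2)) =
      -(2 * P.γ) + δ * (P.γ / (2 * T ^ 2)) * (p ^ 2 - q ^ 2) := fun p q => by
    field_simp
    ring
  -- rewrite the weight pointwise and split the integral
  have hw : ∀ x : PhaseSpace N,
      (∫ y, φ y ∂(P.langevinKernel N (T + δ / 2) (T - δ / 2) s.toNNReal x)) *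
        (Real.exp (-1 / T * P.hamiltonian N x) *
          (P.γ * ((T + δ / 2) * ((-1 / T) ^ 2 * x.2 ⟨0, hN⟩ ^ 2 + -1 / T) + -1 / T * x.2 ⟨0, hN⟩ ^ 2 +
            ((T - δ / 2) * ((-1 / T) ^ 2 * x.2 ⟨N - 1, by omega⟩ ^ 2 + -1 / T) +
              -1 / T * x.2 ⟨N - 1, by omega⟩ ^ 2)))) =
      -(2 * P.γ) * (Real.exp (-1 / T * P.hamiltonian N x) *
          ∫ y, φ y ∂(P.langevinKernel N (T + δ / 2) (T - δ / 2) s.toNNReal x)) +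
        δ * (P.γ / (2 * T ^ 2)) *
          ((∫ y, φ y ∂(P.langevinKernel N (T + δ / 2) (T - δ / 2) s.toNNReal x)) *
            (Real.exp (-1 / T * P.hamiltonian N x) * (x.2 ⟨0, hN⟩ ^ 2 - x.2 ⟨N - 1, by omega⟩ ^ 2))) := by
    intro x
    rw [halg]
    ring
  simp_rw [hw]
  rw [integral_add (hI1.const_mul _) (hI2.const_mul _), integral_const_mul, integral_const_mul]
  ring

omit hT hTL hTR hθ0 hθ1 hφ hK hK0 hr hφ2 in
/-- **Measurability in time of the odd-moment pairing** `s ↦ ∫ P_s φ · e^{-H/T}(p_0² - p_{N-1}²) dx`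
for a strongly measurable `φ` (Fubini measurability from the joint measurability of the kernels).
[folklore] -/
theorem measurable_oddMoment_pairing (hφm : StronglyMeasurable φ) :
    Measurable fun s : ℝ =>
      ∫ x, (∫ y, φ y ∂(P.langevinKernel N (T + δ / 2) (T - δ / 2) s.toNNReal x)) *
        (Real.exp (-1 / T * P.hamiltonian N x) * (x.2 ⟨0, hN⟩ ^ 2 - x.2 ⟨N - 1, by omega⟩ ^ 2)) := by
  have hHc : Continuous (P.hamiltonian N) := (hP.contDiff_hamiltonian N).continuous
  have hw : Continuous fun x : PhaseSpace N =>
      Real.exp (-1 / T * P.hamiltonian N x) * (x.2 ⟨0, hN⟩ ^ 2 - x.2 ⟨N - 1, by omega⟩ ^ 2) :=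
    (Real.continuous_exp.comp (continuous_const.mul hHc)).mul
      ((((continuous_apply _).comp continuous_snd).pow 2).sub (((continuous_apply _).comp continuous_snd).pow 2))
  have h1 := hP.measurable_integral_langevinKernel_uncurry N (T + δ / 2) (T - δ / 2) hφm
  have h2 : Measurable fun p : ℝ × PhaseSpace N => (p.1.toNNReal, p.2) :=
    (measurable_real_toNNReal.comp measurable_fst).prodMk measurable_snd
  have hf : Measurable fun p : ℝ × PhaseSpace N =>
      (∫ y, φ y ∂(P.langevinKernel N (T + δ / 2) (T - δ / 2) p.1.toNNReal p.2)) *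
        (Real.exp (-1 / T * P.hamiltonian N p.2) * (p.2.2 ⟨0, hN⟩ ^ 2 - p.2.2 ⟨N - 1, by omega⟩ ^ 2)) :=
    (h1.comp h2).mul (hw.measurable.comp measurable_snd)
  exact (hf.stronglyMeasurable.integral_prod_right' (ν := volume)).measurable

omit hφ2 hφ in
/-- **The odd Gibbs moment vanishes**: `∫ e^{-H/T} (p_0² - p_{N-1}²) dx = 0` — from the finite-time
response identity with `φ ≡ 1` (`δ ≠ 0`, `ϑ ≥ 0`): the left-hand side vanishes since `P_t 1 = 1`, the
right-hand side is `δ (γ/2T²) t ∫ e^{-H/T}(p_0² - p_{N-1}²) dx`. [folklore] -/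
theorem integral_expWeight_oddMoment_eq_zero (hϑ : 0 ≤ ϑ) (hγ : 0 < P.γ) (hδ : δ ≠ 0) :
    ∫ x : PhaseSpace N, Real.exp (-1 / T * P.hamiltonian N x) * (x.2 ⟨0, hN⟩ ^ 2 - x.2 ⟨N - 1, by omega⟩ ^ 2) = 0 := by
  haveI := fun t => hP.isMarkovKernel_langevinKernel N (T + δ / 2) (T - δ / 2) t
  have hone : ∀ y : PhaseSpace N, |(fun _ : PhaseSpace N => (1 : ℝ)) y| ≤ 1 * Real.exp (ϑ * P.hamiltonian N y) :=
    fun y => by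
      simp only [abs_one, one_mul]
      exact Real.one_le_exp (mul_nonneg hϑ (hP.hamiltonian_nonneg N y))
  have h := hP.finite_time_response_identity hK hK0 hr hN hT hTL hTR hθ0 hθ1 (contDiff_const (c := (1 : ℝ))) hone 1
  have hK1 : ∀ (t : ℝ≥0) (x : PhaseSpace N),
      ∫ _y, (1 : ℝ) ∂(P.langevinKernel N (T + δ / 2) (T - δ / 2) t x) = 1 := fun t x => by simp
  simp_rw [hK1] at h
  simp only [mul_one, one_mul, sub_self, NNReal.coe_one] at h
  rw [intervalIntegral.integral_const, sub_zero, one_smul] at h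
  have hc : δ * (P.γ / (2 * T ^ 2)) ≠ 0 := mul_ne_zero hδ (by positivity)
  exact (mul_eq_zero.1 h.symm).resolve_left hc

end FiniteTime

end SiteChain.UniformlyConfining

end Literature.MathematicalPhysics.KineticTheory.HeatConduction
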